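import Literature.NumberTheory.GaloisRepresentations.EnormousSubgroup
import Literature.NumberTheory.GaloisRepresentations.ResidualGaloisRep
import Literature.NumberTheory.GaloisRepresentations.GSpValued
import HarnessLib

/-!
# Big-image conditions for `GSp₄`: enormous, weakly enormous, vast, tidy
# (Boxer–Calegari–Gee–Pilloni 2021, §7.5: Def. 7.5.2, Def. 7.5.6, Def. 7.5.11)

Topic `Literature/NumberTheory/GaloisRepresentations`, sibling of `EnormousSubgroup.lean` (the
`GL_n` notion of ACC+ / Khare–Thorne, whose `ad⁰` is the TRACE-ZERO matrices) — this file is the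
`GSp₄` variant of G. Boxer, F. Calegari, T. Gee, V. Pilloni, *Abelian surfaces over totally real
fields are potentially modular*, Publ. Math. IHÉS **134** (2021) 153–501, §7.5 "Big image
conditions and vast representations", whose `ad⁰` is the 10-dimensional Lie algebra `𝔰𝔭₄`
(printed p. 392: "for the 10-dimensional representation `ad⁰`").  DEFINITIONS with bodies and
unfolding API only (D-0026: no named fact); they are the hypothesis "ρ̄ is vast and tidy in the
sense of Definitions 7.5.6 and 7.5.11" of the source's Theorem 8.4.1 / Proposition 10.1.1 (the
`GSp₄` modularity lifting theorem, typed as printed for the venture cell `pub-residmod`: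
`run/shared/lean/pub/pub-residmod/lit/BCGP-AS-PRINTED.md`, §A2–A3), vendored so that those
theorems can be stated in the tree's vocabulary.

## The printed definitions (IHÉS text; printed page = file + 152 of `paper:url-00708d1511c4`)

* **Def. 7.5.2 (p. 392 L23–30).** "We say that a subgroup `H ⊂ GSp₄(k)` is enormous if it
  satisfies the following conditions: (E1) `H¹(H, ad⁰) = 0` for the 10-dimensional representation
  `ad⁰`. (E2) `H` acts absolutely irreducibly in its natural representation, in particular,
  `H⁰(H, ad⁰) = 0`. (E3) For all simple `k[H]`-submodules `W ⊂ k ⊗ ad⁰`, there is an element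
  `h ∈ H` such that • `h ∈ GSp₄(k)` has 4 distinct eigenvalues, and • `1` is an eigenvalue for
  the action of `h` on `W`. If `H` only satisfies (E2) and (E3), then we say that `H` is weakly
  enormous."
* **Def. 7.5.6 (p. 394 L16–20).** "A representation `ρ̄ : G_F → GSp₄(k)` is vast if one of the
  following two conditions holds: (1) The image of `ρ̄` restricted to `G_{F(ζ_{p^N})}` is enormous
  for all sufficiently large `N`. (2) The image of `ρ̄` restricted to `G_{F(ζ_{p^N})}` is weakly
  enormous for all sufficiently large `N`, and the fixed field `L` of `ad⁰ρ̄` does not contain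
  `ζ_p`."  (Remark 7.5.7: if `p` is unramified in `F` one may take `N = 3`; Lemma 7.5.5: the
  image is independent of `N ≫ 0`.)
* **Def. 7.5.11 (p. 395 L31–34).** "We say that a subgroup `H ⊂ GSp₄(k)` is tidy if there is an
  `h ∈ H` with `ν(h) ≠ 1`, and such that no two eigenvalues of `h` have ratio `ν(h)` (but the
  eigenvalues need not be distinct). We say that a representation `ρ̄ : G_F → GSp₄(k)` is tidy if
  it has tidy image."  (p. 396 L2: "Note that the property of tidiness is inherited from
  subgroups.")

## What is here (all with bodies; `k` a field, `J ∈ M_n(k)` the Gram matrix of the form)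

* `spLie J : Submodule k (M_n(k))` — `𝔰𝔭(J) = {X : Xᵀ J + J X = 0}`, the Lie algebra of `Sp(J)`;
  for `n = 4` and `J` invertible alternating this is the source's 10-dimensional `ad⁰`.
* `gspSubgroup J : Subgroup (GL_n(k))` — `GSp(J)(k) = {g : ∃ ν ∈ kˣ, gᵀ J g = ν J}` (the tree's
  `IsSimilitude J ν g` of `GSpValued.lean` with a unit multiplier).
* `spAdjoint J` — `𝔰𝔭(J)` as a SUBREPRESENTATION of the adjoint representation
  (`glAdjointRepresentation` of `EnormousSubgroup.lean`, `g • X = g X g⁻¹`) restricted to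
  `GSp(J)(k)`: similitudes normalise `𝔰𝔭(J)` (`conj_mem_spLie`).  `Subgroup.spAdRep H hH` — the
  `k[H]`-module `ad⁰` of a subgroup `H ≤ GSp(J)(k)` (`hH : H ≤ gspSubgroup J`).
* `Subgroup.IsGSp4WeaklyEnormous J H` — (E2) ∧ (E3): `H ≤ GSp(J)`, `H` absolutely irreducible on
  `k⁴` (tree `IsAbsIrreducible H.subtype`), and for every simple `k[H]`-submodule `W` of `ad⁰` (an
  atom of the subrepresentation lattice, as in `EnormousSubgroup.lean`) some `h ∈ H` with 4 distinct
  eigenvalues (separable characteristic polynomial: tree `IsRegularSemisimple`) fixes a non-zero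
  vector of `W` ("1 is an eigenvalue for the action of `h` on `W`").
  `Subgroup.IsGSp4Enormous J H` — additionally (E1): every `1`-cocycle `H → ad⁰` is a coboundary
  (Mathlib `groupCohomology.cocycles₁ ≤ coboundaries₁`, = `H¹(H, ad⁰) = 0` as in the sibling).
* `Subgroup.IsGSp4Tidy J H` — Def. 7.5.11: some `h ∈ H`, a similitude of `J` with multiplier
  `ν ≠ 1`, such that no two roots `μ₁, μ₂` of its characteristic polynomial in `k̄` satisfy
  `μ₁ = ν μ₂`.
* `galCyclotomicPow F p N ≤ Γ_F` — `G_{F(ζ_{p^N})}`: the automorphisms of `F̄` fixing every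
  `p^N`-th root of unity; `FramedGaloisRep.imageOn ρ Γ` — `ρ(Γ) ≤ GL_n(k)`.
* `FramedGaloisRep.IsVast J p ρ` — Def. 7.5.6 verbatim: (1) `ρ(G_{F(ζ_{p^N})})` enormous for all
  `N ≫ 0`, OR (2) weakly enormous for all `N ≫ 0` and `ζ_p ∉ L`, `L` the fixed field of the
  kernel of the action on `ad⁰` (spelled: some `σ` acting trivially on `𝔰𝔭(J)` by `Ad ρ(σ)` moves
  a `p`-th root of unity).  `FramedGaloisRep.IsTidy J ρ` — tidy image.
* API (all proved, no `sorry`): membership/unfolding lemmas, `conj_mem_spLie`,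
  `IsGSp4Enormous.toIsGSp4WeaklyEnormous`, `IsGSp4Enormous.subsingleton_H1`,
  `IsGSp4Tidy.mono` ("inherited from subgroups"), `IsVast.of_enormous` (clause (1) suffices).

## Design notes (what reviewers should check against print)

* `H ⊂ GSp₄(k)`: the source's `H` lives in the similitude group of a FIXED symplectic form; here
  the form is the parameter `J` (any Gram matrix; the intended use is `J` invertible alternating,
  `n = 4`, e.g. the tree's standard `J` of `SymplecticMultiplier*.lean`), and `H` is a subgroup of
  `GL₄(k)` together with the clause `H ≤ gspSubgroup J`.  Enormity is conjugation-invariant, so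
  the choice of `J` in its `GL₄(k)`-orbit is immaterial (not formalised).
* "`k ⊗ ad⁰`" in (E3): `ad⁰ = 𝔰𝔭(J)` is already a `k`-vector space here (the source's `ad⁰` is the
  `k`-Lie algebra of the split group), so the simple `k[H]`-submodules of `ad⁰` are meant; no
  extension of scalars is hidden in the printed clause (compare ACC+ Def. 6.2.28 (3), rendered the
  same way in `EnormousSubgroup.lean`).
* "4 distinct eigenvalues" = separable characteristic polynomial (distinct roots in `k̄`), the
  sibling's `IsRegularSemisimple`; "1 is an eigenvalue of `h` on `W`" = a non-zero `h`-fixed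
  vector in `W` (eigenvalue `1` over `k`; `W` is a `k`-space).
* Vast, clause (2): "the fixed field `L` of `ad⁰ρ̄`" is the field cut out by the kernel of
  `σ ↦ Ad(ρ̄(σ))|_{ad⁰}`; "`L` does not contain `ζ_p`" ⟺ some element of that kernel moves `ζ_p`
  ⟺ (as `p` is prime, every `p`-th root of unity `≠ 1` generates `F(ζ_p)`) some `σ` with
  `Ad(ρ̄(σ)) = id` on `𝔰𝔭(J)` and `σ ζ ≠ ζ` for some `ζ` with `ζ^p = 1`.  "For all sufficiently
  large `N`" = `∃ N₀, ∀ N ≥ N₀`.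
* NOT here (each a separate result of §7.5, wanted as theorems, not facts): Lemma 7.5.3
  (dependence on the projective image only), Lemma 7.5.5/Remark 7.5.7 (`N = 3` suffices for `p`
  unramified), Lemma 7.5.9, Lemma 7.5.12/7.5.13 (tidiness criteria), Lemma 7.5.15 (`Sp₄(𝔽_p)` is
  enormous, `GSp₄(𝔽_p)` tidy — for `p = 3, 5, 7` a Magma computation in print), §7.5.20/Lemma
  7.5.21 (the 11 enormous subgroups of `Sp₄(𝔽₃)`; Magma), Lemma 7.5.22 (induced representations).

## References

* [BoxerEtAl2021] G. Boxer, F. Calegari, T. Gee, V. Pilloni, *Abelian surfaces over totally real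
  fields are potentially modular*, Publ. Math. IHÉS 134 (2021): Def. 7.5.2 (p. 392), Lemma 7.5.3,
  Lemma 7.5.5 (p. 393), Def. 7.5.6 and Remarks 7.5.7–7.5.8 (p. 394), Def. 7.5.11 (p. 395), p. 396
  L2, §2.1–2.2 (`GSp₄`, similitude character `ν`).
* [ACCGHLNSTT2023] P. Allen et al., *Potential automorphy over CM fields*, Ann. of Math. 197
  (2023), Def. 6.2.28 (the `GL_n` notion; `EnormousSubgroup.lean`).
-/

noncomputable section

open scoped MatrixGroups
open Matrix

namespace Literature.NumberTheory.GaloisRepresentations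

universe u v

/-! ### `𝔰𝔭(J)` and `GSp(J)` -/

section SpLie

variable {k : Type u} [Field k] {n : ℕ}

/-- **`𝔰𝔭(J)`**, the Lie algebra of the symplectic group of the form with Gram matrix `J`:
`{X ∈ M_n(k) : Xᵀ J + J X = 0}`.  For `n = 4` and `J` invertible alternating this is the
10-dimensional `ad⁰` of BCGP Def. 7.5.2. [cite: BoxerEtAl2021, §7.5 Def. 7.5.2 (p. 392, "the 10-dimensional representation ad⁰")] -/
def spLie (J : Matrix (Fin n) (Fin n) k) : Submodule k (Matrix (Fin n) (Fin n) k) where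
  carrier := {X | Xᵀ * J + J * X = 0}
  add_mem' {X Y} hX hY := by
    simp only [Set.mem_setOf_eq] at hX hY ⊢
    rw [transpose_add, Matrix.add_mul, Matrix.mul_add, add_add_add_comm, hX, hY, add_zero]
  zero_mem' := by simp
  smul_mem' c X hX := by
    simp only [Set.mem_setOf_eq] at hX ⊢
    rw [transpose_smul, Matrix.smul_mul, Matrix.mul_smul, ← smul_add, hX, smul_zero]

/-- Membership in `𝔰𝔭(J)` (unfolding of the cited definition). [cite: BoxerEtAl2021, §7.5 Def. 7.5.2 (ad⁰ = 𝔰𝔭₄)] -/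
@[simp] lemma mem_spLie_iff (J X : Matrix (Fin n) (Fin n) k) :
    X ∈ spLie J ↔ Xᵀ * J + J * X = 0 := Iff.rfl

/-- **`GSp(J)(k)`** as a subgroup of `GL_n(k)`: the `g` with `gᵀ J g = ν J` for some unit `ν`
(the tree's `IsSimilitude J ν g`). [cite: BoxerEtAl2021, §2.1 (GSp₄ and the similitude character ν)] -/
def gspSubgroup (J : Matrix (Fin n) (Fin n) k) : Subgroup (GL (Fin n) k) where
  carrier := {g | ∃ ν : kˣ, IsSimilitude J (ν : k) ((g : GL (Fin n) k) : Matrix (Fin n) (Fin n) k)}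
  one_mem' := ⟨1, by simpa using IsSimilitude.one J⟩
  mul_mem' {g h} := by
    rintro ⟨ν, hν⟩ ⟨μ, hμ⟩
    exact ⟨ν * μ, by simpa [Units.val_mul] using hν.mul hμ⟩
  inv_mem' {g} := by
    rintro ⟨ν, hν⟩
    refine ⟨ν⁻¹, ?_⟩
    unfold IsSimilitude at hν ⊢
    -- from `gᵀ J g = ν J`: `J = ν • (g⁻ᵀ J g⁻¹)`, hence `g⁻ᵀ J g⁻¹ = ν⁻¹ J`
    have hg : ((g : GL (Fin n) k) : Matrix (Fin n) (Fin n) k) *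
        ((g⁻¹ : GL (Fin n) k) : Matrix (Fin n) (Fin n) k) = 1 := by
      rw [← Units.val_mul, mul_inv_cancel, Units.val_one]
    have hgT : ((g⁻¹ : GL (Fin n) k) : Matrix (Fin n) (Fin n) k)ᵀ *
        ((g : GL (Fin n) k) : Matrix (Fin n) (Fin n) k)ᵀ = 1 := by
      rw [← transpose_mul, hg, transpose_one]
    have key : ((g⁻¹ : GL (Fin n) k) : Matrix (Fin n) (Fin n) k)ᵀ *
        (((g : GL (Fin n) k) : Matrix (Fin n) (Fin n) k)ᵀ * J *
          ((g : GL (Fin n) k) : Matrix (Fin n) (Fin n) k)) *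
        ((g⁻¹ : GL (Fin n) k) : Matrix (Fin n) (Fin n) k) = J := by
      calc _ = (((g⁻¹ : GL (Fin n) k) : Matrix (Fin n) (Fin n) k)ᵀ *
            ((g : GL (Fin n) k) : Matrix (Fin n) (Fin n) k)ᵀ) * J *
            (((g : GL (Fin n) k) : Matrix (Fin n) (Fin n) k) *
              ((g⁻¹ : GL (Fin n) k) : Matrix (Fin n) (Fin n) k)) := by
            simp only [Matrix.mul_assoc]
        _ = J := by rw [hgT, hg, Matrix.one_mul, Matrix.mul_one]
    rw [hν, Matrix.mul_smul, Matrix.smul_mul] at key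
    -- `key : ν • (g⁻ᵀ J g⁻¹) = J`
    have := congrArg (fun M => ((ν⁻¹ : kˣ) : k) • M) key
    simp only [smul_smul, Units.inv_mul, one_smul] at this
    exact this

/-- Membership in `GSp(J)(k)` (unfolding of the cited definition). [cite: BoxerEtAl2021, §2.1 (GSp₄, similitude character)] -/
lemma mem_gspSubgroup_iff (J : Matrix (Fin n) (Fin n) k) (g : GL (Fin n) k) :
    g ∈ gspSubgroup J ↔
      ∃ ν : kˣ, IsSimilitude J (ν : k) ((g : GL (Fin n) k) : Matrix (Fin n) (Fin n) k) :=
  Iff.rfl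

/-- Similitudes normalise `𝔰𝔭(J)`: if `gᵀ J g = ν J` (`ν` a unit) and `Xᵀ J + J X = 0` then
`(g X g⁻¹)ᵀ J + J (g X g⁻¹) = 0` — the adjoint action of `GSp(J)` preserves `ad⁰`.
[cite: BoxerEtAl2021, §7.5 Def. 7.5.2 (ad⁰ as a representation of H ⊂ GSp₄(k))] -/
theorem conj_mem_spLie {J : Matrix (Fin n) (Fin n) k} {g : GL (Fin n) k} (hg : g ∈ gspSubgroup J)
    {X : Matrix (Fin n) (Fin n) k} (hX : X ∈ spLie J) :
    ((g : GL (Fin n) k) : Matrix (Fin n) (Fin n) k) * X *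
        ((g⁻¹ : GL (Fin n) k) : Matrix (Fin n) (Fin n) k) ∈ spLie J := by
  obtain ⟨ν, hν⟩ := hg
  rw [mem_spLie_iff] at hX ⊢
  unfold IsSimilitude at hν
  set G : Matrix (Fin n) (Fin n) k := ((g : GL (Fin n) k) : Matrix (Fin n) (Fin n) k) with hGdef
  set Gi : Matrix (Fin n) (Fin n) k := ((g⁻¹ : GL (Fin n) k) : Matrix (Fin n) (Fin n) k)
    with hGidef
  have hGGi : G * Gi = 1 := by
    rw [hGdef, hGidef, ← Units.val_mul, mul_inv_cancel, Units.val_one]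
  have hGiG : Gi * G = 1 := by
    rw [hGdef, hGidef, ← Units.val_mul, inv_mul_cancel, Units.val_one]
  have hGiT : Giᵀ * Gᵀ = 1 := by rw [← transpose_mul, hGGi, transpose_one]
  -- `Gᵀ J = ν J Gi` and `J G = ν Giᵀ J`
  have h1 : Gᵀ * J = (ν : k) • (J * Gi) := by
    calc Gᵀ * J = Gᵀ * J * (G * Gi) := by rw [hGGi, Matrix.mul_one]
      _ = (Gᵀ * J * G) * Gi := by simp only [Matrix.mul_assoc]
      _ = (ν : k) • (J * Gi) := by rw [hν, Matrix.smul_mul]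
  have h2 : J * G = (ν : k) • (Giᵀ * J) := by
    calc J * G = (Giᵀ * Gᵀ) * J * G := by rw [hGiT, Matrix.one_mul]
      _ = Giᵀ * (Gᵀ * J * G) := by simp only [Matrix.mul_assoc]
      _ = (ν : k) • (Giᵀ * J) := by rw [hν, Matrix.mul_smul]
  calc (G * X * Gi)ᵀ * J + J * (G * X * Gi)
      = Giᵀ * Xᵀ * (Gᵀ * J) + (J * G) * X * Gi := by
        simp only [transpose_mul, Matrix.mul_assoc]
    _ = (ν : k) • (Giᵀ * (Xᵀ * J + J * X) * Gi) := by
        rw [h1, h2]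
        simp only [Matrix.mul_smul, Matrix.smul_mul, Matrix.mul_add, Matrix.add_mul,
          Matrix.mul_assoc, smul_add]
    _ = 0 := by rw [hX, Matrix.mul_zero, Matrix.zero_mul, smul_zero]

/-- **`ad⁰ = 𝔰𝔭(J)` as a subrepresentation** of the adjoint representation `g • X = g X g⁻¹`
restricted to `GSp(J)(k)`. [cite: BoxerEtAl2021, §7.5 Def. 7.5.2] -/
def spAdjoint (J : Matrix (Fin n) (Fin n) k) :
    Subrepresentation ((glAdjointRepresentation (Fin n) k).comp (gspSubgroup J).subtype) where
  toSubmodule := spLie J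
  apply_mem_toSubmodule g X hX := by
    change glAdjointRepresentation (Fin n) k (g : GL (Fin n) k) X ∈ spLie J
    rw [glAdjointRepresentation_apply]
    exact conj_mem_spLie g.2 hX

/-- The `k[H]`-module `ad⁰ = 𝔰𝔭(J)` of a subgroup `H ≤ GSp(J)(k)` (conjugation action), the
module of (E1)–(E3) of BCGP Def. 7.5.2.  Declared in the topic namespace (write
`Subgroup.spAdRep H hH` after `open Literature.NumberTheory.GaloisRepresentations`).
[cite: BoxerEtAl2021, §7.5 Def. 7.5.2] -/
abbrev Subgroup.spAdRep {J : Matrix (Fin n) (Fin n) k} (H : Subgroup (GL (Fin n) k))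
    (hH : H ≤ gspSubgroup J) : Representation k H (spLie J) :=
  (spAdjoint J).toRepresentation.comp (Subgroup.inclusion hH)

/-- Unfolding: `h ∈ H` acts on `X ∈ 𝔰𝔭(J)` by `h X h⁻¹` (the `k[H]`-module `ad⁰` of the cited definition). [cite: BoxerEtAl2021, §7.5 Def. 7.5.2] -/
@[simp] lemma Subgroup.coe_spAdRep_apply {J : Matrix (Fin n) (Fin n) k}
    (H : Subgroup (GL (Fin n) k)) (hH : H ≤ gspSubgroup J) (h : H) (X : spLie J) :
    ((Subgroup.spAdRep H hH h X : spLie J) : Matrix (Fin n) (Fin n) k) =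
      (((h : GL (Fin n) k)) : Matrix (Fin n) (Fin n) k) * (X : Matrix (Fin n) (Fin n) k) *
        ((((h : GL (Fin n) k))⁻¹ : GL (Fin n) k) : Matrix (Fin n) (Fin n) k) :=
  rfl

end SpLie

/-! ### Enormous, weakly enormous, tidy subgroups of `GSp₄(k)` (Def. 7.5.2, Def. 7.5.11) -/

section Enormous

variable {k : Type u} [Field k]

/-- **`H ⊂ GSp₄(k)` is weakly enormous** (BCGP Def. 7.5.2, conditions (E2) and (E3)), for the
symplectic form with Gram matrix `J`:
* `le_gsp` — `H ≤ GSp(J)(k)`;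
* `isAbsIrreducible` — (E2) "`H` acts absolutely irreducibly in its natural representation"
  (tree `IsAbsIrreducible` applied to the inclusion `H →* GL₄(k)`);
* `exists_isRegularSemisimple` — (E3) for every simple `k[H]`-submodule `W ⊆ ad⁰ = 𝔰𝔭(J)` (an atom
  of the lattice of subrepresentations of `Subgroup.spAdRep H le_gsp`) there is `h ∈ H` with 4
  distinct eigenvalues (separable characteristic polynomial, tree `IsRegularSemisimple`) such that
  `1` is an eigenvalue of `h` on `W` (a non-zero `w ∈ W` with `h w h⁻¹ = w`).
[cite: BoxerEtAl2021, §7.5 Def. 7.5.2 (p. 392 L23–30)] -/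
structure Subgroup.IsGSp4WeaklyEnormous (J : Matrix (Fin 4) (Fin 4) k)
    (H : Subgroup (GL (Fin 4) k)) : Prop where
  /-- `H` lies in the similitude group of `J`. -/
  le_gsp : H ≤ gspSubgroup J
  /-- (E2) `H` acts absolutely irreducibly on `k⁴`. -/
  isAbsIrreducible : IsAbsIrreducible H.subtype
  /-- (E3) every simple `k[H]`-submodule of `ad⁰` has a non-zero vector fixed by some element of
  `H` with 4 distinct eigenvalues. -/
  exists_isRegularSemisimple :
    ∀ W : Subrepresentation (Subgroup.spAdRep H le_gsp), IsAtom W →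
      ∃ h : H, IsRegularSemisimple (h : GL (Fin 4) k) ∧
        ∃ w ∈ W, w ≠ 0 ∧ Subgroup.spAdRep H le_gsp h w = w

/-- **`H ⊂ GSp₄(k)` is enormous** (BCGP Def. 7.5.2): weakly enormous ((E2), (E3)) and
(E1) `H¹(H, ad⁰) = 0` — every inhomogeneous `1`-cocycle `H → 𝔰𝔭(J)` is a `1`-coboundary (Mathlib
`groupCohomology.cocycles₁ ≤ coboundaries₁`, which is `H¹ = 0`: `subsingleton_H1`).
[cite: BoxerEtAl2021, §7.5 Def. 7.5.2 (p. 392 L23–30)] -/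
structure Subgroup.IsGSp4Enormous (J : Matrix (Fin 4) (Fin 4) k) (H : Subgroup (GL (Fin 4) k)) :
    Prop extends Subgroup.IsGSp4WeaklyEnormous J H where
  /-- (E1) `H¹(H, ad⁰) = 0`. -/
  cocycles₁_le_coboundaries₁ :
    groupCohomology.cocycles₁ (Rep.of (Subgroup.spAdRep H le_gsp)) ≤
      groupCohomology.coboundaries₁ (Rep.of (Subgroup.spAdRep H le_gsp))

/-- Clause (E1) in Mathlib's group cohomology: for an enormous `H ⊂ GSp₄(k)`, `H¹(H, ad⁰) = 0`
(`groupCohomology.H1` of the `k[H]`-module `𝔰𝔭(J)`), by `H1_induction_on` / `H1π_eq_zero_iff` as in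
the sibling `EnormousSubgroup.lean`. [cite: BoxerEtAl2021, §7.5 Def. 7.5.2 (E1)] -/
theorem Subgroup.IsGSp4Enormous.subsingleton_H1 {J : Matrix (Fin 4) (Fin 4) k}
    {H : Subgroup (GL (Fin 4) k)} (hH : Subgroup.IsGSp4Enormous J H) :
    Subsingleton (groupCohomology.H1 (Rep.of (Subgroup.spAdRep H hH.le_gsp))) := by
  refine ⟨fun x y => ?_⟩
  have h0 : ∀ z : groupCohomology.H1 (Rep.of (Subgroup.spAdRep H hH.le_gsp)), z = 0 := by
    intro z
    induction z using groupCohomology.H1_induction_on with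
    | h f =>
      rw [groupCohomology.H1π_eq_zero_iff]
      exact hH.cocycles₁_le_coboundaries₁ f.2
  rw [h0 x, h0 y]

/-- **`H ⊂ GSp₄(k)` is tidy** (BCGP Def. 7.5.11): there is `h ∈ H`, a similitude of `J` with
multiplier `ν ≠ 1`, such that no two eigenvalues `μ₁, μ₂` of `h` (roots of its characteristic
polynomial in an algebraic closure of `k`, not necessarily distinct) have ratio `ν`:
`μ₁ ≠ ν μ₂`. [cite: BoxerEtAl2021, §7.5 Def. 7.5.11 (p. 395 L31–34)] -/
def Subgroup.IsGSp4Tidy (J : Matrix (Fin 4) (Fin 4) k) (H : Subgroup (GL (Fin 4) k)) : Prop :=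
  ∃ h ∈ H, ∃ ν : k, IsSimilitude J ν ((h : GL (Fin 4) k) : Matrix (Fin 4) (Fin 4) k) ∧ ν ≠ 1 ∧
    ∀ μ₁ ∈ (((h : GL (Fin 4) k) : Matrix (Fin 4) (Fin 4) k).charpoly).aroots (AlgebraicClosure k),
      ∀ μ₂ ∈ (((h : GL (Fin 4) k) : Matrix (Fin 4) (Fin 4) k).charpoly).aroots (AlgebraicClosure k),
        μ₁ ≠ algebraMap k (AlgebraicClosure k) ν * μ₂

/-- Unfolding lemma for `Subgroup.IsGSp4Tidy` (the cited definition verbatim). [cite: BoxerEtAl2021, §7.5 Def. 7.5.11] -/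
lemma Subgroup.isGSp4Tidy_iff (J : Matrix (Fin 4) (Fin 4) k) (H : Subgroup (GL (Fin 4) k)) :
    Subgroup.IsGSp4Tidy J H ↔
      ∃ h ∈ H, ∃ ν : k, IsSimilitude J ν ((h : GL (Fin 4) k) : Matrix (Fin 4) (Fin 4) k) ∧ ν ≠ 1 ∧
        ∀ μ₁ ∈ (((h : GL (Fin 4) k) : Matrix (Fin 4) (Fin 4) k).charpoly).aroots
            (AlgebraicClosure k),
          ∀ μ₂ ∈ (((h : GL (Fin 4) k) : Matrix (Fin 4) (Fin 4) k).charpoly).aroots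
              (AlgebraicClosure k),
            μ₁ ≠ algebraMap k (AlgebraicClosure k) ν * μ₂ :=
  Iff.rfl

/-- "Note that the property of tidiness is inherited from subgroups" (p. 396 L2): if `H′ ≤ H` and
`H′` is tidy then `H` is tidy. [cite: BoxerEtAl2021, §7.5 (p. 396 L2)] -/
theorem Subgroup.IsGSp4Tidy.mono {J : Matrix (Fin 4) (Fin 4) k} {H' H : Subgroup (GL (Fin 4) k)}
    (hle : H' ≤ H) (h : Subgroup.IsGSp4Tidy J H') : Subgroup.IsGSp4Tidy J H := by
  obtain ⟨g, hg, ν, hν⟩ := h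
  exact ⟨g, hle hg, ν, hν⟩

end Enormous

/-! ### Vast and tidy representations `ρ̄ : G_F → GSp₄(k)` (Def. 7.5.6, Def. 7.5.11) -/

section Vast

variable {F : Type v} [Field F] {k : Type u} [Field k] [TopologicalSpace k] {n : ℕ}

/-- `G_{F(ζ_{p^N})} ≤ G_F`: the absolute Galois group of `F(μ_{p^N})`, i.e. the elements of `Γ_F`
fixing every `p^N`-th root of unity of `F̄` (the group over which Def. 7.5.6 takes images). [cite: BoxerEtAl2021, §7.5 Def. 7.5.6 and Lemma 7.5.5 (restriction to G_{F(ζ_{p^N})})] -/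
def galCyclotomicPow (F : Type v) [Field F] (p N : ℕ) : Subgroup (Field.absoluteGaloisGroup F) where
  carrier := {σ | ∀ ζ : AlgebraicClosure F, ζ ^ p ^ N = 1 → σ • ζ = ζ}
  one_mem' ζ _ := one_smul _ ζ
  mul_mem' {σ τ} hσ hτ ζ hζ := by rw [mul_smul, hτ ζ hζ, hσ ζ hζ]
  inv_mem' {σ} hσ ζ hζ := by
    rw [inv_smul_eq_iff]
    exact (hσ ζ hζ).symm

/-- Membership in `galCyclotomicPow` (unfolding). [cite: BoxerEtAl2021, §7.5 Def. 7.5.6 (restriction to G_{F(ζ_{p^N})})] -/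
lemma mem_galCyclotomicPow_iff (p N : ℕ) (σ : Field.absoluteGaloisGroup F) :
    σ ∈ galCyclotomicPow F p N ↔ ∀ ζ : AlgebraicClosure F, ζ ^ p ^ N = 1 → σ • ζ = ζ :=
  Iff.rfl

/-- The image `ρ(Γ) ≤ GL_n(k)` of a subgroup `Γ ≤ Γ_F` under a framed Galois representation
("the image of `ρ̄` restricted to `G_{F(ζ_{p^N})}`"). [cite: BoxerEtAl2021, §7.5 Def. 7.5.6] -/
def FramedGaloisRep.imageOn (ρ : FramedGaloisRep F k n) (Γ : Subgroup (Field.absoluteGaloisGroup F)) :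
    Subgroup (GL (Fin n) k) :=
  Γ.map (ρ : Field.absoluteGaloisGroup F →* GL (Fin n) k)

/-- Membership in `FramedGaloisRep.imageOn` (unfolding). [cite: BoxerEtAl2021, §7.5 Def. 7.5.6] -/
lemma FramedGaloisRep.mem_imageOn_iff (ρ : FramedGaloisRep F k n)
    (Γ : Subgroup (Field.absoluteGaloisGroup F)) (g : GL (Fin n) k) :
    g ∈ ρ.imageOn Γ ↔ ∃ σ ∈ Γ, ρ σ = g :=
  Subgroup.mem_map

/-- **`ρ̄ : G_F → GSp₄(k)` is vast** (BCGP Def. 7.5.6, for the form `J` and the prime `p`): EITHER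
(1) the image of `ρ̄|_{G_{F(ζ_{p^N})}}` is enormous for all sufficiently large `N`, OR (2) it is
weakly enormous for all sufficiently large `N` and "the fixed field `L` of `ad⁰ρ̄` does not contain
`ζ_p`": some `σ ∈ Γ_F` acting trivially on `ad⁰ = 𝔰𝔭(J)` through `Ad ρ̄(σ)` (i.e. `σ ∈ Gal(F̄/L)`)
moves a `p`-th root of unity. [cite: BoxerEtAl2021, §7.5 Def. 7.5.6 (p. 394 L16–20)] -/
def FramedGaloisRep.IsVast (J : Matrix (Fin 4) (Fin 4) k) (p : ℕ) (ρ : FramedGaloisRep F k 4) :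
    Prop :=
  (∃ N₀ : ℕ, ∀ N ≥ N₀, Subgroup.IsGSp4Enormous J (ρ.imageOn (galCyclotomicPow F p N))) ∨
  ((∃ N₀ : ℕ, ∀ N ≥ N₀, Subgroup.IsGSp4WeaklyEnormous J (ρ.imageOn (galCyclotomicPow F p N))) ∧
    ∃ σ : Field.absoluteGaloisGroup F,
      (∀ X ∈ spLie J,
        ((ρ σ : GL (Fin 4) k) : Matrix (Fin 4) (Fin 4) k) * X *
          (((ρ σ)⁻¹ : GL (Fin 4) k) : Matrix (Fin 4) (Fin 4) k) = X) ∧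
      ∃ ζ : AlgebraicClosure F, ζ ^ p = 1 ∧ σ • ζ ≠ ζ)

/-- Clause (1) of Def. 7.5.6 suffices for vastness. [cite: BoxerEtAl2021, §7.5 Def. 7.5.6 (1)] -/
theorem FramedGaloisRep.IsVast.of_enormous {J : Matrix (Fin 4) (Fin 4) k} {p : ℕ}
    {ρ : FramedGaloisRep F k 4}
    (h : ∃ N₀ : ℕ, ∀ N ≥ N₀, Subgroup.IsGSp4Enormous J (ρ.imageOn (galCyclotomicPow F p N))) :
    ρ.IsVast J p :=
  Or.inl h

/-- **`ρ̄ : G_F → GSp₄(k)` is tidy** (BCGP Def. 7.5.11): its image `ρ̄(Γ_F)` is a tidy subgroup.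
[cite: BoxerEtAl2021, §7.5 Def. 7.5.11 (p. 395 L34)] -/
def FramedGaloisRep.IsTidy (J : Matrix (Fin 4) (Fin 4) k) (ρ : FramedGaloisRep F k 4) : Prop :=
  Subgroup.IsGSp4Tidy J (ρ.imageOn ⊤)

/-- Unfolding lemma for `FramedGaloisRep.IsTidy`: a tidy element in the image ("ρ̄ is tidy if it has tidy image"). [cite: BoxerEtAl2021, §7.5 Def. 7.5.11] -/
lemma FramedGaloisRep.isTidy_iff (J : Matrix (Fin 4) (Fin 4) k) (ρ : FramedGaloisRep F k 4) :
    ρ.IsTidy J ↔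
      ∃ σ : Field.absoluteGaloisGroup F, ∃ ν : k,
        IsSimilitude J ν ((ρ σ : GL (Fin 4) k) : Matrix (Fin 4) (Fin 4) k) ∧ ν ≠ 1 ∧
        ∀ μ₁ ∈ (((ρ σ : GL (Fin 4) k) : Matrix (Fin 4) (Fin 4) k).charpoly).aroots
            (AlgebraicClosure k),
          ∀ μ₂ ∈ (((ρ σ : GL (Fin 4) k) : Matrix (Fin 4) (Fin 4) k).charpoly).aroots
              (AlgebraicClosure k),
            μ₁ ≠ algebraMap k (AlgebraicClosure k) ν * μ₂ := by
  unfold FramedGaloisRep.IsTidy Subgroup.IsGSp4Tidy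
  constructor
  · rintro ⟨h, hh, ν, hν⟩
    obtain ⟨σ, -, rfl⟩ := (ρ.mem_imageOn_iff ⊤ h).1 hh
    exact ⟨σ, ν, hν⟩
  · rintro ⟨σ, ν, hν⟩
    exact ⟨ρ σ, (ρ.mem_imageOn_iff ⊤ _).2 ⟨σ, Subgroup.mem_top σ, rfl⟩, ν, hν⟩

end Vast

/-! ### Appended: a characteristic-polynomial criterion for tidiness (Def. 7.5.11)

For a concrete subgroup (e.g. the certified mod-`p` image of an abelian surface) tidiness is
decided from ONE element: `h ∈ H` with multiplier `ν ≠ 1` whose characteristic polynomial `χ` is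
coprime to `χ(ν⁻¹ X)` — for then no two roots of `χ` in `k̄` have ratio `ν` (a common root `μ₁` of
`χ` and `χ(ν⁻¹ X)` is exactly a root with `μ₁ / ν` again a root).  Over a finite `k` the coprimality
is a Bézout identity in `k[X]`, checkable by the kernel. -/

section TidyCriterion

variable {k : Type u} [Field k]

/-- **Tidiness from one characteristic polynomial** (criterion for BCGP Def. 7.5.11): if `h ∈ H` is a
similitude of `J` with multiplier `ν ≠ 1` and the characteristic polynomial `χ` of `h` is coprime to
`χ(ν⁻¹ X)` (`χ.comp (C ν⁻¹ * X)`), then `H` is tidy — no two eigenvalues `μ₁, μ₂` of `h` in `k̄`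
satisfy `μ₁ = ν μ₂`, since such a `μ₁` would be a common root of `χ` and `χ(ν⁻¹ X)`.
[cite: BoxerEtAl2021, §7.5 Def. 7.5.11 (p. 395 L31–34: "no two eigenvalues of h have ratio ν(h)")] -/
theorem Subgroup.isGSp4Tidy_of_isCoprime_charpoly_comp {J : Matrix (Fin 4) (Fin 4) k}
    {H : Subgroup (GL (Fin 4) k)} {h : GL (Fin 4) k} (hh : h ∈ H) {ν : k}
    (hsim : IsSimilitude J ν ((h : GL (Fin 4) k) : Matrix (Fin 4) (Fin 4) k)) (hν : ν ≠ 1)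
    (hcop : IsCoprime ((h : GL (Fin 4) k) : Matrix (Fin 4) (Fin 4) k).charpoly
      ((((h : GL (Fin 4) k) : Matrix (Fin 4) (Fin 4) k).charpoly).comp
        (Polynomial.C ν⁻¹ * Polynomial.X))) :
    Subgroup.IsGSp4Tidy J H := by
  classical
  refine ⟨h, hh, ν, hsim, hν, fun μ₁ hμ₁ μ₂ hμ₂ heq => ?_⟩
  set χ : Polynomial k := ((h : GL (Fin 4) k) : Matrix (Fin 4) (Fin 4) k).charpoly
  have h₁ : Polynomial.aeval μ₁ χ = 0 := (Polynomial.mem_aroots'.1 hμ₁).2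
  have h₂ : Polynomial.aeval μ₂ χ = 0 := (Polynomial.mem_aroots'.1 hμ₂).2
  -- `μ₁` is also a root of `χ(ν⁻¹ X)`: `ν⁻¹ μ₁` is `μ₂` (if `ν ≠ 0`) or `0 = μ₁` (if `ν = 0`)
  have h₃ : Polynomial.aeval μ₁ (χ.comp (Polynomial.C ν⁻¹ * Polynomial.X)) = 0 := by
    rw [Polynomial.aeval_comp, map_mul, Polynomial.aeval_C, Polynomial.aeval_X]
    by_cases hν0 : ν = 0
    · subst hν0
      have hμ₁ : μ₁ = 0 := by rw [heq, map_zero, zero_mul]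
      rw [_root_.inv_zero, map_zero, zero_mul]
      rw [hμ₁] at h₁
      exact h₁
    · have : algebraMap k (AlgebraicClosure k) ν⁻¹ * μ₁ = μ₂ := by
        rw [heq, ← mul_assoc, ← map_mul, inv_mul_cancel₀ hν0, map_one, one_mul]
      rw [this, h₂]
  obtain ⟨a, b, hab⟩ := hcop
  have := congrArg (Polynomial.aeval μ₁) hab
  rw [map_add, map_mul, map_mul, h₁, h₃, mul_zero, mul_zero, add_zero, map_one] at this
  exact zero_ne_one this

end TidyCriterion

end Literature.NumberTheory.GaloisRepresentations
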